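import Literature.Analysis.SpecialFunctions.LegendrePolynomials
import Mathlib.Analysis.Calculus.IteratedDeriv.Lemmas
import Mathlib.Analysis.Calculus.ContDiff.Basic
import Mathlib.Analysis.SpecialFunctions.Trigonometric.Deriv
import HarnessLib

/-!
# Legendre coefficients of smooth functions: Rodrigues' formula integrated by parts, and the bound
# `|∫_{-1}^1 f P_n| ≤ sup|f⁽ⁿ⁾| · 2^{n+1} n!/(2n+1)!`

Topic `Literature/Analysis/SpecialFunctions` (classical special-function analysis), continuing the tree's
`LegendrePolynomials` (Rodrigues' `P_n = (2ⁿ n!)⁻¹ dⁿ(x²−1)ⁿ`, `integral_iterate_derivative_legendreW_mul` for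
POLYNOMIAL test functions, `integral_one_sub_sq_pow`, `factorial_mul_wallis_prod`).  Here the test function
is any `Cⁿ` function `g : ℝ → ℝ`:

* `integral_derivative_eval_mul_fun` — integration by parts on `[−1, 1]` of `p′·g`, `p ∈ ℝ[X]`, `g ∈ C¹`;
* `integral_iterate_derivative_legendreW_mul_fun` — the `n`-fold integration by parts
  `∫_{-1}^1 (dⁿW_n) g = (−1)^j ∫_{-1}^1 (d^{n−j}W_n) g^{(j)}` (`j ≤ n`; the boundary terms vanish since `±1`
  are roots of `W_n = (x²−1)ⁿ` of multiplicity `n`);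
* **`integral_legendre_mul_eq_integral_iteratedDeriv`** — `∫_{-1}^1 P_n g = (2ⁿ n!)⁻¹ ∫_{-1}^1 (1−x²)ⁿ g⁽ⁿ⁾(x) dx`
  (Rodrigues' formula "integrated by parts", Arfken–Weber §12.4; with `g = xⁿ` it is Ex. 12.4.4
  `∫ xⁿP_n = 2^{n+1}(n!)²/(2n+1)!`);
* **`abs_integral_legendre_mul_le`** — `|g⁽ⁿ⁾| ≤ M` on `[−1,1]` ⇒ `|∫_{-1}^1 P_n g| ≤ M · 2^{n+1} n!/(2n+1)!`
  (super-geometric decay of the Legendre coefficients of functions with controlled derivatives);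
* **`abs_integral_legendre_mul_cos_le`** — `|∫_{-1}^1 P_n(x) cos(a x) dx| ≤ |a|ⁿ · 2^{n+1} n!/(2n+1)!` for all
  real `a` (uniform in the frequency on compacts: `|a| ≤ A ⇒ ≤ Aⁿ 2^{n+1} n!/(2n+1)!`).

Motivation / first use (cell rh-crit, sub-cell cc, 2026-08-26): the Legendre coefficients `c_k(ω₀)` of
`x ↦ cos(2πω₀x)` enter the explicit index-wise bound of the prolate eigenvalues `λ(n)` (track (iv) of the
K3 tail input, `ProlateEigenvalueExplicitDecay`) through `λ(n)ψ_n(ω₀) = ∫ψ_n(x)cos(2πxω₀)dx = Σ_k c_k(ω₀)b_k`;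
the bound here is the `ω₀`-uniform control of the `c_k`.  RH-FREE classical analysis; WHAT THIS IS NOT: an
eigenvalue bound, a certificate, or anything about RH — nothing here bears on the truth of RH.
Everything here is PROVED; no definition, no named fact.

## References
* G. B. Arfken, H. J. Weber, *Mathematical Methods for Physicists*, 4th ed., Academic Press 1995, §12.4
  "Rodrigues' formula" p. 587–588 and Exercises 12.4.2–12.4.4 (Rodrigues + integration by parts). [ArfkenWeber1995]
* G. E. Andrews, R. Askey, R. Roy, *Special Functions*, CUP 1999, Remark 2.5.1 (2.5.13'), (2.5.14). [AndrewsAskeyRoy1999]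
-/

noncomputable section

open Polynomial intervalIntegral MeasureTheory Finset Set
open scoped Nat

namespace Literature.Analysis.SpecialFunctions

/-! ### Integration by parts against a smooth function -/

/-- Integration by parts on `[−1, 1]` for a polynomial against a `C¹` function:
`∫ p′ g = p(1)g(1) − p(−1)g(−1) − ∫ p g′`.
[cite: ArfkenWeber1995, §12.4 Ex. 12.4.2 ("use Rodrigues' formula and integrate by parts")] -/
theorem integral_derivative_eval_mul_fun (p : ℝ[X]) {g g' : ℝ → ℝ} (hg : ∀ x, HasDerivAt g (g' x) x)
    (hg' : Continuous g') :
    ∫ x in (-1 : ℝ)..1, (derivative p).eval x * g x =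
      p.eval 1 * g 1 - p.eval (-1) * g (-1) - ∫ x in (-1 : ℝ)..1, p.eval x * g' x := by
  have h := integral_mul_deriv_eq_deriv_mul (a := (-1 : ℝ)) (b := 1)
    (u := g) (v := fun x => p.eval x) (u' := g') (v' := fun x => (derivative p).eval x)
    (fun x _ => hg x) (fun x _ => p.hasDerivAt x)
    (hg'.intervalIntegrable _ _) ((Polynomial.continuous _).intervalIntegrable _ _)
  calc ∫ x in (-1 : ℝ)..1, (derivative p).eval x * g x
      = ∫ x in (-1 : ℝ)..1, g x * (derivative p).eval x := by
        refine intervalIntegral.integral_congr fun x _ => ?_; ring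
    _ = g 1 * p.eval 1 - g (-1) * p.eval (-1) - ∫ x in (-1 : ℝ)..1, g' x * p.eval x := h
    _ = _ := by
        rw [mul_comm (g 1), mul_comm (g (-1))]
        congr 1
        refine intervalIntegral.integral_congr fun x _ => ?_; ring

/-- **The `n`-fold integration by parts behind Rodrigues' formula, smooth test function**: for `g ∈ Cⁿ`
and `j ≤ n`, `∫_{-1}^1 (dⁿ W_n) g = (−1)^j ∫_{-1}^1 (d^{n−j} W_n) g^{(j)}` (all boundary terms vanish by
`eval_iterate_derivative_legendreW_eq_zero`).
[cite: ArfkenWeber1995, §12.4 Rodrigues' formula (12.65) p. 587 and Ex. 12.4.2–12.4.4 p. 588; AndrewsAskeyRoy1999, (2.5.14)] -/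
theorem integral_iterate_derivative_legendreW_mul_fun (n : ℕ) {g : ℝ → ℝ} (hg : ContDiff ℝ n g) {j : ℕ}
    (hj : j ≤ n) :
    ∫ x in (-1 : ℝ)..1, (derivative^[n] (legendreW n)).eval x * g x =
      (-1) ^ j * ∫ x in (-1 : ℝ)..1,
        (derivative^[n - j] (legendreW n)).eval x * iteratedDeriv j g x := by
  induction j with
  | zero => simp
  | succ j ih =>
    rw [ih (Nat.le_of_succ_le hj)]
    have hlt : j < n := hj
    -- `d^{n-j} W = (d^{n-j-1} W)'`
    have hsplit : derivative^[n - j] (legendreW n) =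
        derivative (derivative^[n - (j + 1)] (legendreW n)) := by
      rw [← Function.iterate_succ_apply' derivative]
      congr 1; omega
    -- `g^{(j)}` is `C¹` with derivative `g^{(j+1)}`
    have hdiff : Differentiable ℝ (iteratedDeriv j g) :=
      hg.differentiable_iteratedDeriv j (by exact_mod_cast hlt)
    have hder : ∀ x, HasDerivAt (iteratedDeriv j g) (iteratedDeriv (j + 1) g x) x := fun x => by
      rw [iteratedDeriv_succ]
      exact (hdiff x).hasDerivAt
    have hcont : Continuous (iteratedDeriv (j + 1) g) :=
      hg.continuous_iteratedDeriv (j + 1) (by exact_mod_cast hj)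
    rw [hsplit, integral_derivative_eval_mul_fun _ hder hcont]
    have hvan := eval_iterate_derivative_legendreW_eq_zero (n := n) (j := n - (j + 1)) (by omega)
    rw [hvan.1, hvan.2, zero_mul, zero_mul, sub_zero, zero_sub, ← intervalIntegral.integral_neg, pow_succ,
      mul_assoc, ← intervalIntegral.integral_const_mul, ← intervalIntegral.integral_const_mul,
      ← intervalIntegral.integral_const_mul]
    refine intervalIntegral.integral_congr fun x _ => ?_
    ring

/-- **Rodrigues' formula integrated by parts**: for `g ∈ Cⁿ`,
`∫_{-1}^1 P_n(x) g(x) dx = (2ⁿ n!)⁻¹ ∫_{-1}^1 (1 − x²)ⁿ g⁽ⁿ⁾(x) dx`.  (With `g = xⁿ`, `g⁽ⁿ⁾ = n!`, this is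
Arfken–Weber Ex. 12.4.4 `∫ xⁿ P_n = 2^{n+1}(n!)²/(2n+1)!`; with `deg g < n` it is orthogonality, Ex. 12.4.3.)
[cite: ArfkenWeber1995, §12.4 Rodrigues' formula (12.65) p. 587, Ex. 12.4.3–12.4.4 p. 588; AndrewsAskeyRoy1999, Remark 2.5.1 (2.5.13')] -/
theorem integral_legendre_mul_eq_integral_iteratedDeriv (n : ℕ) {g : ℝ → ℝ} (hg : ContDiff ℝ n g) :
    ∫ x in (-1 : ℝ)..1, (legendre n).eval x * g x =
      (1 / (2 ^ n * (n ! : ℝ))) * ∫ x in (-1 : ℝ)..1, (1 - x ^ 2) ^ n * iteratedDeriv n g x := by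
  have h := integral_iterate_derivative_legendreW_mul_fun n hg le_rfl
  rw [Nat.sub_self, Function.iterate_zero_apply] at h
  simp only [legendre, eval_mul, eval_C, mul_assoc]
  rw [intervalIntegral.integral_const_mul, h, ← intervalIntegral.integral_const_mul ((-1 : ℝ) ^ n)]
  congr 1
  refine intervalIntegral.integral_congr fun x _ => ?_
  simp only [legendreW, eval_pow, eval_sub, eval_X, eval_one]
  rw [← mul_assoc, ← mul_pow]
  congr 2
  ring

/-- `∫_{-1}^1 (1 − x²)ⁿ dx = 2 · 4ⁿ (n!)² / (2n+1)!` (the tree's `integral_one_sub_sq_pow` and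
`factorial_mul_wallis_prod`). [cite: ArfkenWeber1995, §12.4 Ex. 12.4.4 p. 588 (the value `2^{n+1}(n!)²/(2n+1)!` of `∫xⁿP_n`)] -/
theorem integral_one_sub_sq_pow_eq_factorial (n : ℕ) :
    ∫ x in (-1 : ℝ)..1, (1 - x ^ 2) ^ n = 2 * 4 ^ n * (n ! : ℝ) ^ 2 / (2 * n + 1)! := by
  rw [integral_one_sub_sq_pow]
  have hf : ((2 * n + 1)! : ℝ) ≠ 0 := by positivity
  rw [eq_div_iff hf]
  linear_combination 2 * factorial_mul_wallis_prod n

/-- **Decay of the Legendre coefficients of a function with controlled derivatives**: if `g ∈ Cⁿ` and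
`|g⁽ⁿ⁾| ≤ M` on `[−1, 1]`, then `|∫_{-1}^1 P_n g| ≤ M · 2^{n+1} n! / (2n+1)!`.
[cite: ArfkenWeber1995, §12.4 Rodrigues' formula p. 587 and Ex. 12.4.2–12.4.4 p. 588; AndrewsAskeyRoy1999, Remark 2.5.1] -/
theorem abs_integral_legendre_mul_le (n : ℕ) {g : ℝ → ℝ} (hg : ContDiff ℝ n g) {M : ℝ}
    (hM : ∀ x ∈ Icc (-1 : ℝ) 1, |iteratedDeriv n g x| ≤ M) :
    |∫ x in (-1 : ℝ)..1, (legendre n).eval x * g x| ≤ M * (2 ^ (n + 1) * n ! / (2 * n + 1)!) := by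
  have hM0 : 0 ≤ M := (abs_nonneg _).trans (hM 0 (by norm_num))
  have hcont : Continuous (iteratedDeriv n g) := hg.continuous_iteratedDeriv n le_rfl
  rw [integral_legendre_mul_eq_integral_iteratedDeriv n hg, abs_mul,
    abs_of_pos (by positivity : (0 : ℝ) < 1 / (2 ^ n * (n ! : ℝ)))]
  -- `|∫ (1-x²)ⁿ g⁽ⁿ⁾| ≤ ∫ (1-x²)ⁿ M`
  have hle : |∫ x in (-1 : ℝ)..1, (1 - x ^ 2) ^ n * iteratedDeriv n g x| ≤
      ∫ x in (-1 : ℝ)..1, (1 - x ^ 2) ^ n * M := by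
    have hi1 : IntervalIntegrable (fun x : ℝ => |(1 - x ^ 2) ^ n * iteratedDeriv n g x|) volume (-1) 1 :=
      (((by fun_prop : Continuous fun x : ℝ => (1 - x ^ 2) ^ n).mul hcont).abs).intervalIntegrable _ _
    have hi2 : IntervalIntegrable (fun x : ℝ => (1 - x ^ 2) ^ n * M) volume (-1) 1 :=
      (by fun_prop : Continuous fun x : ℝ => (1 - x ^ 2) ^ n * M).intervalIntegrable _ _
    refine (intervalIntegral.abs_integral_le_integral_abs (by norm_num)).trans
      (intervalIntegral.integral_mono_on (by norm_num) hi1 hi2 fun x hx => ?_)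
    have hw : 0 ≤ (1 - x ^ 2) ^ n := pow_nonneg (by nlinarith [hx.1, hx.2]) n
    rw [abs_mul, abs_of_nonneg hw]
    exact mul_le_mul_of_nonneg_left (hM x hx) hw
  calc 1 / (2 ^ n * (n ! : ℝ)) * |∫ x in (-1 : ℝ)..1, (1 - x ^ 2) ^ n * iteratedDeriv n g x|
      ≤ 1 / (2 ^ n * (n ! : ℝ)) * ∫ x in (-1 : ℝ)..1, (1 - x ^ 2) ^ n * M := by gcongr
    _ = M * (2 ^ (n + 1) * n ! / (2 * n + 1)!) := by
        rw [intervalIntegral.integral_mul_const, integral_one_sub_sq_pow_eq_factorial]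
        have h4 : (4 : ℝ) ^ n = 2 ^ n * 2 ^ n := by rw [← mul_pow]; norm_num
        rw [h4]
        field_simp
        ring

/-- **Legendre coefficients of a cosine wave, uniformly in the frequency**: for all real `a` and all `n`,
`|∫_{-1}^1 P_n(x) cos(a x) dx| ≤ |a|ⁿ · 2^{n+1} n!/(2n+1)!` (`(cos(a·))⁽ⁿ⁾ = aⁿ cos⁽ⁿ⁾(a·)` and
`|cos⁽ⁿ⁾| ≤ 1`).  For `a = 2πω₀`, `|ω₀| ≤ 1`, even index `2k`, and the orthonormal family
`P̃_{2k} = ((4k+1)/2)^{1/2} P_{2k}` this is the `ω₀`-uniform bound of the Legendre coefficients `c_k(ω₀)` of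
`x ↦ cos(2πω₀x)`.
[cite: ArfkenWeber1995, §12.4 Rodrigues' formula p. 587 and Ex. 12.4.2–12.4.4 p. 588; AndrewsAskeyRoy1999, Remark 2.5.1] -/
theorem abs_integral_legendre_mul_cos_le (n : ℕ) (a : ℝ) :
    |∫ x in (-1 : ℝ)..1, (legendre n).eval x * Real.cos (a * x)| ≤
      |a| ^ n * (2 ^ (n + 1) * n ! / (2 * n + 1)!) := by
  have hcos : ContDiff ℝ n (fun x : ℝ => Real.cos (a * x)) :=
    Real.contDiff_cos.comp (contDiff_const.mul contDiff_id)
  refine abs_integral_legendre_mul_le n hcos fun x _ => ?_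
  rw [iteratedDeriv_comp_const_mul (Real.contDiff_cos.of_le le_top) a, abs_mul, abs_pow]
  exact mul_le_of_le_one_right (by positivity) (Real.abs_iteratedDeriv_cos_le_one n (a * x))

/-- The frequency-uniform form: `|a| ≤ A ⇒ |∫_{-1}^1 P_n(x) cos(a x) dx| ≤ Aⁿ · 2^{n+1} n!/(2n+1)!`.
[cite: ArfkenWeber1995, §12.4 Rodrigues' formula p. 587 and Ex. 12.4.2–12.4.4 p. 588] -/
theorem abs_integral_legendre_mul_cos_le_of_abs_le (n : ℕ) {a A : ℝ} (ha : |a| ≤ A) :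
    |∫ x in (-1 : ℝ)..1, (legendre n).eval x * Real.cos (a * x)| ≤
      A ^ n * (2 ^ (n + 1) * n ! / (2 * n + 1)!) := by
  refine (abs_integral_legendre_mul_cos_le n a).trans ?_
  gcongr

end Literature.Analysis.SpecialFunctions
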